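import Literature.NumberTheory.Rogawski1990.ArchInnerTransferCongruence   -- ★ FILE 2 (T-d): `corresponds_archCongr_right_iff`, `isConj_coe_archCongr`
import Literature.NumberTheory.Rogawski1990.DeltaTransferTransport         -- ★ `TransferFactorData.comap`, `isDeltaTransferRel_comap_iff` (generic «`Δ″ = Δ ∘ ψ`»)
import HarnessLib

/-!
# The archimedean congruence transport, ENDOSCOPIC half: norm pairs `γ_H → γ`, the transfer factor `Δ′_∞ ∘ (id × Φ)` and the Δ-transfer relation (4.3.1) on `U(H)(L ⊗ ℝ)`
# under `g ↦ T g T⁻¹ : U(H₂)(L ⊗ ℝ) ≃ₜ* U(H)(L ⊗ ℝ)` (ROAD-Sd (T-d), FILE 5 = memo items (b)+(c)(vi) for `arch`; Rogawski 1990 §14.4 p. 237 «`Δ″_v = Δ_v ∘ ψ_v`», §4.3 (4.3.1))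

Topic `NumberTheory/Rogawski1990`; namespace `Literature.NumberTheory.Rogawski1990`.  THEOREMS ONLY (no `def`, no instance, no notation, no axiom, no named fact, no `sorry`).  Cell
`pub/hodgecm-mathlib`, ENGINE T1 (crux H413 = `stmt-HodgeConjecture-24833`); floor-1 preparation, count-neutral, under books rows #88 (ST-∞) ∕ #111 (S-d) ∕ `stub_Sc` (S-c): ROAD-Sd item
(T-d) «CONGRUENCE TRANSPORT» (LEAD DESK WORDS T8-39 ∕ T8-42, F0P3a-plan (g9), 2026-09-01; memo of record F0P3a-p06 (g9) `ROAD-Sd-3prime-congruence` items (b) «transported transfer factor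
`T″ := T ∘ (id × φ)` + `IsArchNormPair` invariance» and (c)(vi) «Δ-transfer»; census `CENSUS-Td-CongruenceTransport.F0P3a-p02g10.md` 9b2b941dccae668a FILE 2 §6); author F0P3a-p02 (g10).
Sequel of ★ FILE 2 `ArchInnerTransferCongruence` (the inner-transfer side) over the GENERIC ★ `DeltaTransferTransport` §1 (whose §2–§3 are the finite-place readings).

WHY.  The closer's (S-c) ∕ (ST-∞) statements read the archimedean Δ-transfer `f′_∞ → f′^H_∞` (★ `IsArchDeltaTransfer L H′ T mH mG aH a`, (4.3.1) at `∞`) for a factor `T : ArchTransferFactor L H′`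
supported on the norm pairs `γ_H → γ′` (★ `IsArchNormPair L H′ γ_H γ′` = `ι_∞(γ_H)` conjugate to `γ′` in `GL₃(L ⊗ ℝ)`).  Along a congruence `Φ : U(H₂)(L ⊗ ℝ) ≃ₜ* U(H)(L ⊗ ℝ)`,
`g ↦ T g T⁻¹` (an AMBIENT conjugation), norm pairs are preserved, so the factor pulls back to `Δ ∘ (id × Φ)` on `U(H₂)` (★ `TransferFactorData.comap`) — print's «the transfer factor for
`(H, G′)` is `Δ″_v = Δ_v ∘ ψ_v`» [Rogawski1990 §14.4 p. 237] — and (4.3.1) for `(Δ ∘ Φ, m₂, a₂)` on `U(H₂)` IS (4.3.1) for `(Δ, Φ_* m₂, a₂ ∘ Φ⁻¹)` on `U(H)` (★ `isDeltaTransferRel_comap_iff`);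
the `H_∞`-side (`mH`, `aH`, `G`-regularity, stable conjugacy in `H_∞`) is untouched.

WHAT IS PROVED (abstract `Φ` with `hΦ : ↑(Φ g) = T·↑g·T⁻¹`; `N = 3`).
* §1 **`isArchNormPair_archCongr_iff`**: `γ_H → Φ g ↔ γ_H → g`; `isArchNormPair_archCongr_symm_iff`.
* §2 `archTransferFactor_comap_Δ` (the pulled-back factor `(T.comap Φ _).Δ γ_H g = T.Δ γ_H (Φ g)`, `rfl`), **`isArchNondegenerate_comap_iff`** (non-degeneracy on the matching `G`-regular pairs is
  kept, `Φ` onto).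
* §3 **`isArchDeltaTransfer_comap_iff`**: `IsArchDeltaTransfer L H₂ (T.comap Φ _) mH m₂ aH a₂ ↔ IsArchDeltaTransfer L H T mH (Φ_* m₂) aH (a₂ ∘ Φ⁻¹)`; the existential form
  `exists_isArchDeltaTransfer_comap_iff` («`a₂` HAS a `Δ∘Φ`-transfer iff `a₂ ∘ Φ⁻¹` has a `Δ`-transfer», same `f^H`).
HONEST LABEL: HC_CM is proved only modulo the printed citations until rung 0 closes; this file is bookkeeping and pays nothing by itself.

## References
* [Rogawski1990] J. D. Rogawski, *Automorphic Representations of Unitary Groups in Three Variables*, Ann. of Math. Stud. 123 (1990), §14.4 p. 237 («`Δ″_v = Δ_v ∘ ψ_v`, and `f′_v → f′_v^H` is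
  defined via `f_v = f′_v ∘ ψ_v⁻¹`»), §14.3 pp. 233–234, §4.3 (4.3.1) p. 43, §4.9 pp. 54–55.
* [LanglandsShelstad1987] R. P. Langlands, D. Shelstad, *On the definition of transfer factors*, Math. Ann. 278 (1987), §1 (transfer factors as functions of matching pairs).
* [PlatonovRapinchuk1994] V. Platonov, A. Rapinchuk, *Algebraic Groups and Number Theory* (1994), §2.3.
-/

set_option autoImplicit false

noncomputable section

open MeasureTheory NumberField NumberField.InfinitePlace NumberField.mixedEmbedding Topology
open scoped Matrix MatrixGroups

namespace Literature.NumberTheory.Rogawski1990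

open Literature.MeasureTheory.Group Literature.NumberTheory.Automorphic

section Delta

variable (L : Type) [Field L] [NumberField L] [IsCMField L] {H H₂ : Matrix (Fin 3) (Fin 3) L} (T : GL (Fin 3) (mixedSpace L))
  (Φ : UnitaryGroup.arch (↥(maximalRealSubfield L)) L (IsCMField.complexConj L) 3 H₂ ≃ₜ* UnitaryGroup.arch (↥(maximalRealSubfield L)) L (IsCMField.complexConj L) 3 H)
  (hΦ : ∀ g : UnitaryGroup.arch (↥(maximalRealSubfield L)) L (IsCMField.complexConj L) 3 H₂,
    ((Φ g : UnitaryGroup.arch (↥(maximalRealSubfield L)) L (IsCMField.complexConj L) 3 H) : GL (Fin 3) (mixedSpace L)) = T * (g : GL (Fin 3) (mixedSpace L)) * T⁻¹)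

/-! ## §1 Norm pairs under `Φ` -/

include hΦ in
/-- **NORM PAIRS ARE CARRIED BY `Φ`**: `γ_H → Φ g ↔ γ_H → g` (`ι_∞(γ_H)` is conjugate in `GL₃(L ⊗ ℝ)` to `Φ g = T g T⁻¹` iff to `g`; ★ FILE 2 `corresponds_archCongr_right_iff`).
[cite: Rogawski1990, §14.3 p. 234; §14.4 p. 237] -/
theorem isArchNormPair_archCongr_iff
    (γH : UnitaryGroup.arch (↥(maximalRealSubfield L)) L (IsCMField.complexConj L) 2 (Matrix.of fun i j : Fin 2 => if i.val + j.val + 1 = 2 then (1 : L) else 0) ×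
      UnitaryGroup.arch (↥(maximalRealSubfield L)) L (IsCMField.complexConj L) 1 (Matrix.of fun i j : Fin 1 => if i.val + j.val + 1 = 1 then (1 : L) else 0))
    (g : UnitaryGroup.arch (↥(maximalRealSubfield L)) L (IsCMField.complexConj L) 3 H₂) :
    IsArchNormPair L H γH (Φ g) ↔ IsArchNormPair L H₂ γH g :=
  corresponds_archCongr_right_iff L T Φ hΦ (endoEmbArch L γH) g

include hΦ in
/-- The same along `Φ⁻¹`: `γ_H → Φ⁻¹ γ ↔ γ_H → γ`. [cite: Rogawski1990, §14.3 p. 234; §14.4 p. 237] -/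
theorem isArchNormPair_archCongr_symm_iff
    (γH : UnitaryGroup.arch (↥(maximalRealSubfield L)) L (IsCMField.complexConj L) 2 (Matrix.of fun i j : Fin 2 => if i.val + j.val + 1 = 2 then (1 : L) else 0) ×
      UnitaryGroup.arch (↥(maximalRealSubfield L)) L (IsCMField.complexConj L) 1 (Matrix.of fun i j : Fin 1 => if i.val + j.val + 1 = 1 then (1 : L) else 0))
    (γ : UnitaryGroup.arch (↥(maximalRealSubfield L)) L (IsCMField.complexConj L) 3 H) :
    IsArchNormPair L H₂ γH (Φ.symm γ) ↔ IsArchNormPair L H γH γ := by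
  rw [← isArchNormPair_archCongr_iff L T Φ hΦ γH (Φ.symm γ), ContinuousMulEquiv.apply_symm_apply]

/-! ## §2 The pulled-back factor `Δ ∘ (id × Φ)` -/

/-- **`Δ″ = Δ ∘ (id × Φ)`**: the archimedean factor of `U(H)` pulled back to `U(H₂)` along `Φ` (★ `TransferFactorData.comap` with the norm-pair compatibility of §1) evaluates as
`(T.comap Φ _).Δ γ_H g = T.Δ γ_H (Φ g)` (definitional). [cite: Rogawski1990, §14.4 p. 237] -/
theorem archTransferFactor_comap_Δ (TΔ : ArchTransferFactor L H)
    (hR : ∀ γH g, IsArchNormPair L H γH (Φ.toMulEquiv g) → IsArchNormPair L H₂ γH g)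
    (γH : UnitaryGroup.arch (↥(maximalRealSubfield L)) L (IsCMField.complexConj L) 2 (Matrix.of fun i j : Fin 2 => if i.val + j.val + 1 = 2 then (1 : L) else 0) ×
      UnitaryGroup.arch (↥(maximalRealSubfield L)) L (IsCMField.complexConj L) 1 (Matrix.of fun i j : Fin 1 => if i.val + j.val + 1 = 1 then (1 : L) else 0))
    (g : UnitaryGroup.arch (↥(maximalRealSubfield L)) L (IsCMField.complexConj L) 3 H₂) :
    (TΔ.comap Φ.toMulEquiv hR : ArchTransferFactor L H₂).Δ γH g = TΔ.Δ γH (Φ g) :=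
  rfl

include hΦ in
/-- The norm-pair compatibility `hR` that ★ `TransferFactorData.comap` wants, supplied by §1 (so consumers write `TΔ.comap Φ.toMulEquiv (isArchNormPair_of_archCongr L T Φ hΦ)`).
[cite: Rogawski1990, §14.4 p. 237] -/
theorem isArchNormPair_of_archCongr :
    ∀ (γH : UnitaryGroup.arch (↥(maximalRealSubfield L)) L (IsCMField.complexConj L) 2 (Matrix.of fun i j : Fin 2 => if i.val + j.val + 1 = 2 then (1 : L) else 0) ×
        UnitaryGroup.arch (↥(maximalRealSubfield L)) L (IsCMField.complexConj L) 1 (Matrix.of fun i j : Fin 1 => if i.val + j.val + 1 = 1 then (1 : L) else 0))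
      (g : UnitaryGroup.arch (↥(maximalRealSubfield L)) L (IsCMField.complexConj L) 3 H₂),
      IsArchNormPair L H γH (Φ.toMulEquiv g) → IsArchNormPair L H₂ γH g :=
  fun γH g h => (isArchNormPair_archCongr_iff L T Φ hΦ γH g).1 h

include hΦ in
/-- **NON-DEGENERACY IS KEPT**: `Δ ∘ (id × Φ)` is non-degenerate on the matching `G`-regular pairs of `U(H₂)` iff `Δ` is on those of `U(H)` (`Φ` is onto and carries norm pairs).
[cite: Rogawski1990, §4.9 pp. 54–55; §14.4 p. 237] [cite: LanglandsShelstad1987, §1] -/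
theorem isArchNondegenerate_comap_iff (TΔ : ArchTransferFactor L H) :
    IsArchNondegenerate L H₂ (TΔ.comap Φ.toMulEquiv (isArchNormPair_of_archCongr L T Φ hΦ)) ↔ IsArchNondegenerate L H TΔ := by
  rw [isArchNondegenerate_iff, isArchNondegenerate_iff]
  constructor
  · intro h γH γ hN hreg
    have h' := h γH (Φ.symm γ) ((isArchNormPair_archCongr_symm_iff L T Φ hΦ γH γ).2 hN) hreg
    rw [archTransferFactor_comap_Δ] at h'
    rwa [ContinuousMulEquiv.apply_symm_apply] at h'
  · intro h γH g hN hreg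
    rw [archTransferFactor_comap_Δ]
    exact h γH (Φ g) ((isArchNormPair_archCongr_iff L T Φ hΦ γH g).2 hN) hreg

/-! ## §3 (4.3.1) under `Φ` -/

variable
  [∀ a : (UnitaryGroup.arch (↥(maximalRealSubfield L)) L (IsCMField.complexConj L) 2 (Matrix.of fun i j : Fin 2 => if i.val + j.val + 1 = 2 then (1 : L) else 0) ×
      UnitaryGroup.arch (↥(maximalRealSubfield L)) L (IsCMField.complexConj L) 1 (Matrix.of fun i j : Fin 1 => if i.val + j.val + 1 = 1 then (1 : L) else 0)),
    MeasurableSpace ((UnitaryGroup.arch (↥(maximalRealSubfield L)) L (IsCMField.complexConj L) 2 (Matrix.of fun i j : Fin 2 => if i.val + j.val + 1 = 2 then (1 : L) else 0) ×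
        UnitaryGroup.arch (↥(maximalRealSubfield L)) L (IsCMField.complexConj L) 1 (Matrix.of fun i j : Fin 1 => if i.val + j.val + 1 = 1 then (1 : L) else 0)) ⧸
      Subgroup.centralizer ({a} : Set (UnitaryGroup.arch (↥(maximalRealSubfield L)) L (IsCMField.complexConj L) 2 (Matrix.of fun i j : Fin 2 => if i.val + j.val + 1 = 2 then (1 : L) else 0) ×
        UnitaryGroup.arch (↥(maximalRealSubfield L)) L (IsCMField.complexConj L) 1 (Matrix.of fun i j : Fin 1 => if i.val + j.val + 1 = 1 then (1 : L) else 0))))]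
  [∀ γ : UnitaryGroup.arch (↥(maximalRealSubfield L)) L (IsCMField.complexConj L) 3 H,
    MeasurableSpace (UnitaryGroup.arch (↥(maximalRealSubfield L)) L (IsCMField.complexConj L) 3 H ⧸
      Subgroup.centralizer ({γ} : Set (UnitaryGroup.arch (↥(maximalRealSubfield L)) L (IsCMField.complexConj L) 3 H)))]
  [∀ γ : UnitaryGroup.arch (↥(maximalRealSubfield L)) L (IsCMField.complexConj L) 3 H,
    BorelSpace (UnitaryGroup.arch (↥(maximalRealSubfield L)) L (IsCMField.complexConj L) 3 H ⧸
      Subgroup.centralizer ({γ} : Set (UnitaryGroup.arch (↥(maximalRealSubfield L)) L (IsCMField.complexConj L) 3 H)))]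
  [∀ γ : UnitaryGroup.arch (↥(maximalRealSubfield L)) L (IsCMField.complexConj L) 3 H₂,
    MeasurableSpace (UnitaryGroup.arch (↥(maximalRealSubfield L)) L (IsCMField.complexConj L) 3 H₂ ⧸
      Subgroup.centralizer ({γ} : Set (UnitaryGroup.arch (↥(maximalRealSubfield L)) L (IsCMField.complexConj L) 3 H₂)))]
  [∀ γ : UnitaryGroup.arch (↥(maximalRealSubfield L)) L (IsCMField.complexConj L) 3 H₂,
    BorelSpace (UnitaryGroup.arch (↥(maximalRealSubfield L)) L (IsCMField.complexConj L) 3 H₂ ⧸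
      Subgroup.centralizer ({γ} : Set (UnitaryGroup.arch (↥(maximalRealSubfield L)) L (IsCMField.complexConj L) 3 H₂)))]

include hΦ in
/-- **(4.3.1) AT `∞` IS INVARIANT UNDER CONGRUENCE OF THE INNER FORM**: for a factor `Δ` of `U(H)`, a family `mH` and function `aH` on `H_∞`, a family `m₂` and function `a₂` on `U(H₂)(L ⊗ ℝ)`:
`aH` is a `(Δ ∘ Φ)`-transfer of `a₂` (measures `m₂`) iff `aH` is a `Δ`-transfer of `a₂ ∘ Φ⁻¹` (measures `Φ_* m₂`) — «`f′_v → f′_v^H` is defined via `f_v = f′_v ∘ ψ_v⁻¹`» (★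
`isDeltaTransferRel_comap_iff` read on `arch`). [cite: Rogawski1990, §14.4 p. 237; §4.3 (4.3.1) p. 43] -/
theorem isArchDeltaTransfer_comap_iff (TΔ : ArchTransferFactor L H)
    (mH : OrbitalMeasureFamily (UnitaryGroup.arch (↥(maximalRealSubfield L)) L (IsCMField.complexConj L) 2 (Matrix.of fun i j : Fin 2 => if i.val + j.val + 1 = 2 then (1 : L) else 0) ×
      UnitaryGroup.arch (↥(maximalRealSubfield L)) L (IsCMField.complexConj L) 1 (Matrix.of fun i j : Fin 1 => if i.val + j.val + 1 = 1 then (1 : L) else 0)))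
    (m₂ : OrbitalMeasureFamily (UnitaryGroup.arch (↥(maximalRealSubfield L)) L (IsCMField.complexConj L) 3 H₂))
    (aH : UnitaryGroup.arch (↥(maximalRealSubfield L)) L (IsCMField.complexConj L) 2 (Matrix.of fun i j : Fin 2 => if i.val + j.val + 1 = 2 then (1 : L) else 0) ×
      UnitaryGroup.arch (↥(maximalRealSubfield L)) L (IsCMField.complexConj L) 1 (Matrix.of fun i j : Fin 1 => if i.val + j.val + 1 = 1 then (1 : L) else 0) → ℂ)
    (a₂ : UnitaryGroup.arch (↥(maximalRealSubfield L)) L (IsCMField.complexConj L) 3 H₂ → ℂ) :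
    IsArchDeltaTransfer L H₂ (TΔ.comap Φ.toMulEquiv (isArchNormPair_of_archCongr L T Φ hΦ)) mH m₂ aH a₂ ↔
      IsArchDeltaTransfer L H TΔ mH (m₂.transport Φ.toMulEquiv Φ.continuous Φ.symm.continuous) aH (a₂ ∘ Φ.symm) :=
  isDeltaTransferRel_comap_iff Φ.toMulEquiv Φ.continuous Φ.symm.continuous (isArchNormPair_of_archCongr L T Φ hΦ) (IsArchStablyConjH L) (IsArchGRegular L)
    TΔ mH m₂ aH a₂

include hΦ in
/-- Existential form: `a₂` HAS a `(Δ ∘ Φ)`-transfer (within any class `P` of `H_∞`-functions) iff `a₂ ∘ Φ⁻¹` has a `Δ`-transfer in `P`, with the same `f^H`.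
[cite: Rogawski1990, §14.4 p. 237; §14.3 pp. 233–234] -/
theorem exists_isArchDeltaTransfer_comap_iff (TΔ : ArchTransferFactor L H)
    (mH : OrbitalMeasureFamily (UnitaryGroup.arch (↥(maximalRealSubfield L)) L (IsCMField.complexConj L) 2 (Matrix.of fun i j : Fin 2 => if i.val + j.val + 1 = 2 then (1 : L) else 0) ×
      UnitaryGroup.arch (↥(maximalRealSubfield L)) L (IsCMField.complexConj L) 1 (Matrix.of fun i j : Fin 1 => if i.val + j.val + 1 = 1 then (1 : L) else 0)))
    (m₂ : OrbitalMeasureFamily (UnitaryGroup.arch (↥(maximalRealSubfield L)) L (IsCMField.complexConj L) 3 H₂))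
    (P : (UnitaryGroup.arch (↥(maximalRealSubfield L)) L (IsCMField.complexConj L) 2 (Matrix.of fun i j : Fin 2 => if i.val + j.val + 1 = 2 then (1 : L) else 0) ×
      UnitaryGroup.arch (↥(maximalRealSubfield L)) L (IsCMField.complexConj L) 1 (Matrix.of fun i j : Fin 1 => if i.val + j.val + 1 = 1 then (1 : L) else 0) → ℂ) → Prop)
    (a₂ : UnitaryGroup.arch (↥(maximalRealSubfield L)) L (IsCMField.complexConj L) 3 H₂ → ℂ) :
    (∃ aH, P aH ∧ IsArchDeltaTransfer L H₂ (TΔ.comap Φ.toMulEquiv (isArchNormPair_of_archCongr L T Φ hΦ)) mH m₂ aH a₂) ↔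
      ∃ aH, P aH ∧ IsArchDeltaTransfer L H TΔ mH (m₂.transport Φ.toMulEquiv Φ.continuous Φ.symm.continuous) aH (a₂ ∘ Φ.symm) :=
  exists_congr fun aH => and_congr Iff.rfl (isArchDeltaTransfer_comap_iff L T Φ hΦ TΔ mH m₂ aH a₂)

end Delta

end Literature.NumberTheory.Rogawski1990

end
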